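import Summits.ABC.IUTFork.LDHGenuinePerImageSufficiencyRamifiedFun
import HarnessLib

/-!
# The fork at [IUTchIII] Corollary 3.12, L-DH level, READING (P): the UNCONDITIONAL closed-form per-image sufficiency at ANY degree using BOTH
# cyclotomic layers of a genuine datum — `μ_l ⊆ K` (over `l`) and `μ_30 ⊆ F` (over the good places above `3`, `5`) (proof-only)

Record-only PROOF file (D-0012) of the abc-iut cell (branch C certificate seat abc-iut-C-cert-1, gen 6; row «C:ZETA-CUT», part 2; part 1 =
`LDHGenuinePerImageSufficiencyRamifiedFun.lean`). TAKES NO SIDE on [IUTchIII] Cor. 3.12.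

* **`cor312PerImageOf_of_le_degree_thirty`** — ANY degree `d = [F_tpd : ℚ]`, prime `l ≥ 7`, `d_mod ≤ (l+5)/4`, NO ramification hypothesis, NO named fact:
  `((l+1)/24 − 1/(2l))·log q^{∤2l} ≤ ((l+5)/4 − d_mod)·(log-diff + (1 − 1/l)·log 𝔣^{∤2l} + max(0, 1 − d/(l−1))·(1/d)·log l`
  `+ max(0, 1 − d/2)·(1/d)·Σ_{v | 3 good} log N(v) + max(0, 1 − d/4)·(1/d)·Σ_{v | 5 good} log N(v)) + ((l+5)/4)·log π ⟹ T.Cor312PerImageOf`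
  at EVERY genuine `T`, where «good» = not a pole of `j(λ)` (`placesOver F_tpd p \ 𝕍^bad_mod`). At `d = 1` the right side gains `(1/2)·log 3`
  (if `3` is not a bad prime of `λ`) and `(3/4)·log 5` (if `5` is not) over p475570's / abc-iut-s2-p4's p471287 test;
* `le_degree_thirty_of_le_degree` — p475570's inequality implies this one (the `max` clamps and the nonnegative new terms), so every ζ-cut binder built
  on the new test is WEAKER-OR-EQUAL than the p476110/p476209 ones.

HONEST SCOPE. Statements about the cell's typed objects; nothing asserts that data exist at any `(λ, l)`, nothing asserts Cor. 3.12 in general or in print's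
reading, nothing asserts abc. proved-as-typed ≠ in print. [cite: Mochizuki2012, IUTchI Def. 3.1 (c) p. 62; IUTchIII Cor. 3.12 p. 173–174; IUTchIV Thm. 1.10 p. 22,
Step (ii) p. 24, Step (v) p. 27–29] [cite: MochizukiGenEll2010, Prop. 1.7 (i) p. 9–10] [cite: SilvermanAEC2009, Cor. III.8.1.1] [cite: Washington1997, Lemma 1.4
and Prop. 2.1] [claim: Mochizuki2012, status: disputed] for every IUT quotation. PROOF-ONLY: no definitions, no new `Prop`.
-/

noncomputable section

open NumberField IsDedekindDomain Ideal Module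

namespace Literature.IUT.LogVolume.Cor22

open Literature.NumberTheory.DiophantineGeometry.GenEll Summit.ABC.IUTFork Literature.IUT.HodgeTheaters
open Literature.NumberTheory.NumberFields

/-! ## 4. The unconditional closed form, any degree, both cyclotomic layers -/

open scoped Classical in
/-- **ANY DEGREE, UNCONDITIONAL, BOTH CYCLOTOMIC LAYERS.** For a point `λ ∈ U` over a number field `F_tpd` of degree `d`, a prime `l ≥ 7` with
`d_mod ≤ (l+5)/4`: if `((l+1)/24 − 1/(2l))·log q^{∤2l}(λ) ≤ ((l+5)/4 − d_mod)·(log-diff(λ) + (1 − 1/l)·log 𝔣^{∤2l}(λ) + max(0, 1 − d/(l−1))·(1/d)·log l`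
`+ max(0, 1 − d/2)·(1/d)·Σ_{v | 3, v ∉ 𝕍^bad_mod} log N(v) + max(0, 1 − d/4)·(1/d)·Σ_{v | 5, v ∉ 𝕍^bad_mod} log N(v)) + ((l+5)/4)·log π`
then `T.Cor312PerImageOf` at EVERY genuine Θ-volume datum `T` of `(λ, l)` — §2 at `Sₓ = {v₀ ∋ l} ∪ (placesOver F_tpd 3 \ 𝕍^bad_mod) ∪ (placesOver F_tpd 5 \ 𝕍^bad_mod)`
with the floors `m_v` = least integer `≥ (p_v − 1)/d` forced by `μ_l ⊆ K` (abc-iut-s2-p4) and `μ_30 ⊆ F` (abc-iut-W-neg-1, §3); NO ramification hypothesis, NO named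
fact. At `d = 1`: gains `(1 − 1/(l−1))·log l` [p475570] `+ (1/2)·log 3` if `3` is not a bad prime of `λ` `+ (3/4)·log 5` if `5` is not.
[cite: Mochizuki2012, IUTchIII Cor. 3.12 p. 173–174] [cite: Mochizuki2012, IUTchIV Thm. 1.10 p. 22, Step (ii) p. 24, Step (v) p. 27–29]
[cite: SilvermanAEC2009, Cor. III.8.1.1] [cite: Washington1997, Lemma 1.4 and Prop. 2.1] [claim: Mochizuki2012, status: disputed] -/
theorem cor312PerImageOf_of_le_degree_thirty {P : NFPoint} {l : ℕ} (hU : P.InU) (hl : l.Prime) (h7 : 7 ≤ l)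
    (hd : (dmod P : ℝ) ≤ ((l : ℝ) + 5) / 4)
    (h : (((l : ℝ) + 1) / 24 - 1 / (2 * l)) * logQAvoid P {2, l} ≤
      (((l : ℝ) + 5) / 4 - dmod P) * (P.logDiff + (1 - 1 / (l : ℝ)) * logCondAvoid P {2, l}
          + max 0 (1 - (P.degree : ℝ) / ((l : ℝ) - 1)) * ((P.degree : ℝ)⁻¹ * Real.log l)
          + max 0 (1 - (P.degree : ℝ) / 2) * ((P.degree : ℝ)⁻¹ *
              ∑ v ∈ placesOver P.F 3 \ badPlacesAvoid P {2, l}, Real.log (absNorm v.asIdeal : ℝ))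
          + max 0 (1 - (P.degree : ℝ) / 4) * ((P.degree : ℝ)⁻¹ *
              ∑ v ∈ placesOver P.F 5 \ badPlacesAvoid P {2, l}, Real.log (absNorm v.asIdeal : ℝ)))
        + ((l : ℝ) + 5) / 4 * Real.log Real.pi)
    (T : ThetaVolumeDatumAt P l) : T.Cor312PerImageOf := by
  letI := T.instFieldF; letI := T.instNumberFieldF; letI := T.instAlgebraF; letI := T.instFieldK
  letI := T.instNumberFieldK; letI := T.instAlgebraK; letI := T.instFieldFbar; letI := T.instAlgebraFbar
  letI := T.instAlgebraKFbar; letI := T.instIsElliptic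
  letI : Algebra P.F T.K := ((algebraMap T.F T.K).comp (algebraMap P.F T.F)).toAlgebra
  have h5 : 5 ≤ l := le_trans (by norm_num) h7
  haveI hF3 : Fact (Nat.Prime 3) := ⟨Nat.prime_three⟩
  haveI hF5 : Fact (Nat.Prime 5) := ⟨Nat.prime_five⟩
  -- a place `v₀` of `F_tpd` over `l`
  haveI : Fact l.Prime := ⟨hl⟩
  obtain ⟨⟨Q, hQ, hQo⟩⟩ := Ideal.nonempty_primesOver (S := 𝓞 P.F) (Ideal.span {(l : ℤ)})
  have hQ0 : Q ≠ ⊥ :=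
    Ideal.ne_bot_of_liesOver_of_ne_bot (by simp [hl.ne_zero] : Ideal.span {(l : ℤ)} ≠ ⊥) Q
  let v₀ : HeightOneSpectrum (𝓞 P.F) := ⟨Q, hQ, hQ0⟩
  have hmem : ((l : ℕ) : 𝓞 P.F) ∈ v₀.asIdeal := by
    have h1 : ((l : ℕ) : ℤ) ∈ Q.under ℤ := hQo.over ▸ Ideal.mem_span_singleton_self (l : ℤ)
    have h2 := Ideal.mem_comap.mp h1
    rwa [map_natCast] at h2
  have hres : residueChar P.F v₀ = l := (natCast_mem_asIdeal_iff_residueChar_eq v₀ hl).1 hmem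
  have hnot : v₀ ∉ badPlacesAvoid P {2, l} := by
    intro hbad
    unfold badPlacesAvoid at hbad
    exact (Finset.mem_filter.1 hbad).2 l (Finset.mem_insert_of_mem (Finset.mem_singleton_self l)) hmem
  -- the good places over `3` and `5`
  set G3 : Finset (HeightOneSpectrum (𝓞 P.F)) := placesOver P.F 3 \ badPlacesAvoid P {2, l} with hG3
  set G5 : Finset (HeightOneSpectrum (𝓞 P.F)) := placesOver P.F 5 \ badPlacesAvoid P {2, l} with hG5
  have hres3 : ∀ v ∈ G3, residueChar P.F v = 3 := fun v hv =>
    (mem_placesOver_iff_residueChar v).1 (Finset.mem_sdiff.1 hv).1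
  have hres5 : ∀ v ∈ G5, residueChar P.F v = 5 := fun v hv =>
    (mem_placesOver_iff_residueChar v).1 (Finset.mem_sdiff.1 hv).1
  have hl3 : l ≠ 3 := by omega
  have hl5 : l ≠ 5 := by omega
  have hv0G3 : v₀ ∉ G3 := fun hv => hl3 (hres.symm.trans (hres3 v₀ hv))
  have hv0G5 : v₀ ∉ G5 := fun hv => hl5 (hres.symm.trans (hres5 v₀ hv))
  have hdis03 : Disjoint ({v₀} : Finset (HeightOneSpectrum (𝓞 P.F))) G3 := Finset.disjoint_singleton_left.2 hv0G3
  have hdis35 : Disjoint G3 G5 := Finset.disjoint_left.2 fun v h3 h5' => by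
    have := (hres3 v h3).symm.trans (hres5 v h5'); omega
  have hdisU5 : Disjoint ({v₀} ∪ G3) G5 :=
    Finset.disjoint_union_left.2 ⟨Finset.disjoint_singleton_left.2 hv0G5, hdis35⟩
  set Sx : Finset (HeightOneSpectrum (𝓞 P.F)) := {v₀} ∪ G3 ∪ G5 with hSx
  have hmemSx : ∀ v ∈ Sx, v = v₀ ∨ v ∈ G3 ∨ v ∈ G5 := by
    intro v hv
    rcases Finset.mem_union.1 hv with hv | hv
    · rcases Finset.mem_union.1 hv with hv | hv
      · exact Or.inl (Finset.mem_singleton.1 hv)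
      · exact Or.inr (Or.inl hv)
    · exact Or.inr (Or.inr hv)
  have hdisjSx : Disjoint (badPlacesAvoid P {2, l}) Sx := by
    refine Finset.disjoint_left.2 fun v hb hS => ?_
    rcases hmemSx v hS with hv | hv | hv
    · rw [hv] at hb; exact hnot hb
    · exact (Finset.mem_sdiff.1 hv).2 hb
    · exact (Finset.mem_sdiff.1 hv).2 hb
  -- the floors: `m_v` = least `k` with `p_v − 1 ≤ d·k`
  have hd0 : 0 < P.degree := P.degree_pos
  have hex : ∀ v : HeightOneSpectrum (𝓞 P.F), ∃ k : ℕ, residueChar P.F v - 1 ≤ P.degree * k :=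
    fun v => ⟨residueChar P.F v - 1, Nat.le_mul_of_pos_left _ hd0⟩
  set m : HeightOneSpectrum (𝓞 P.F) → ℕ := fun v => Nat.find (hex v) with hm_def
  have hmspec : ∀ v, residueChar P.F v - 1 ≤ P.degree * m v := fun v => Nat.find_spec (hex v)
  have hmmin : ∀ v e, residueChar P.F v - 1 ≤ P.degree * e → m v ≤ e := fun v e he => Nat.find_min' (hex v) he
  have hm0 : ∀ v, 0 < m v := by
    intro v
    have hp := residueChar_prime P.F v
    rcases Nat.eq_zero_or_pos (m v) with h0 | h0
    · have := hmspec v; rw [h0, mul_zero] at this; have := hp.two_le; omega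
    · exact h0
  -- `e(v | p_v) ≤ d`
  have he1 : ∀ v : HeightOneSpectrum (𝓞 P.F), ramIdx P.F v ≤ P.degree := by
    intro v
    haveI : v.asIdeal.IsMaximal := v.isMaximal
    haveI : (v.asIdeal.under ℤ).IsMaximal := Ideal.IsMaximal.under ℤ v.asIdeal
    have h0 : v.asIdeal.under ℤ ≠ ⊥ := mt Ideal.eq_bot_of_comap_eq_bot v.ne_bot
    have hle : v.asIdeal.ramificationIdx ℤ ≤ Module.finrank ℚ P.F := by
      rw [← Ideal.ramificationIdx'_eq_ramificationIdx (v.asIdeal.under ℤ) v.asIdeal h0]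
      exact Ideal.ramificationIdx_le_finrank (𝓞 P.F) ℚ P.F v.asIdeal (p := v.asIdeal.under ℤ)
    rw [← ramIdx_eq] at hle
    exact hle
  -- the ramification hypothesis over `Sₓ` with these floors HOLDS
  have hram : ∀ v ∈ Sx, ∀ w ∈ IsDedekindDomain.primesOverFinset v.asIdeal (𝓞 T.K), m v ≤ ramificationIdx' v.asIdeal w := by
    intro v hv w hw
    have hdvd : (residueChar P.F v - 1) ∣ ramIdx P.F v * ramificationIdx' v.asIdeal w := by
      rcases hmemSx v hv with hv' | hv' | hv'
      · rw [hv'] at hw ⊢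
        rw [hres]
        exact T.D.sub_one_dvd_ramIdx_mul_ramificationIdx' v₀ hmem hw
      · rw [hres3 v hv']
        exact T.sub_one_dvd_ramIdx_mul_ramificationIdx'_of_dvd_thirty Nat.prime_three (by norm_num) v
          ((natCast_mem_asIdeal_iff_residueChar_eq v Nat.prime_three).2 (hres3 v hv')) hw
      · rw [hres5 v hv']
        exact T.sub_one_dvd_ramIdx_mul_ramificationIdx'_of_dvd_thirty Nat.prime_five (by norm_num) v
          ((natCast_mem_asIdeal_iff_residueChar_eq v Nat.prime_five).2 (hres5 v hv')) hw
    haveI : v.asIdeal.IsMaximal := v.isMaximal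
    have hw' := (IsDedekindDomain.mem_primesOverFinset_iff v.ne_bot (𝓞 T.K)).mp hw
    haveI : w.IsPrime := hw'.1
    haveI : w.LiesOver v.asIdeal := hw'.2
    have he2 : 0 < ramificationIdx' v.asIdeal w :=
      Nat.pos_of_ne_zero (Ideal.IsDedekindDomain.ramificationIdx'_ne_zero_of_liesOver w v.ne_bot)
    have hprod : 0 < ramIdx P.F v * ramificationIdx' v.asIdeal w :=
      Nat.mul_pos (Nat.pos_of_ne_zero (ramIdx_ne_zero P.F v)) he2
    have hle : residueChar P.F v - 1 ≤ ramIdx P.F v * ramificationIdx' v.asIdeal w := Nat.le_of_dvd hprod hdvd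
    exact hmmin v _ (hle.trans (Nat.mul_le_mul_right _ (he1 v)))
  -- the real factors: `max(0, 1 − d/(p_v − 1)) ≤ 1 − 1/m_v`
  have hdR : (0 : ℝ) < (P.degree : ℝ) := by exact_mod_cast hd0
  have hfac : ∀ v : HeightOneSpectrum (𝓞 P.F),
      max 0 (1 - (P.degree : ℝ) / ((residueChar P.F v : ℝ) - 1)) ≤ 1 - (m v : ℝ)⁻¹ := by
    intro v
    have hp := residueChar_prime P.F v
    have hmR : (0 : ℝ) < (m v : ℝ) := by exact_mod_cast hm0 v
    have hp1 : (0 : ℝ) < (residueChar P.F v : ℝ) - 1 := by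
      have : (2 : ℝ) ≤ (residueChar P.F v : ℝ) := by exact_mod_cast hp.two_le
      linarith
    have hdmR : (residueChar P.F v : ℝ) - 1 ≤ (P.degree : ℝ) * (m v : ℝ) := by
      have h1 : ((residueChar P.F v - 1 : ℕ) : ℝ) = (residueChar P.F v : ℝ) - 1 := by
        rw [Nat.cast_sub hp.one_lt.le]; push_cast; ring
      rw [← h1]; exact_mod_cast hmspec v
    refine max_le ?_ ?_
    · have : (m v : ℝ)⁻¹ ≤ 1 := inv_le_one_of_one_le₀ (by exact_mod_cast hm0 v)
      linarith
    · have hinv : (m v : ℝ)⁻¹ ≤ (P.degree : ℝ) / ((residueChar P.F v : ℝ) - 1) := by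
        rw [le_div_iff₀ hp1]
        calc (m v : ℝ)⁻¹ * ((residueChar P.F v : ℝ) - 1)
            ≤ (m v : ℝ)⁻¹ * ((P.degree : ℝ) * (m v : ℝ)) :=
              mul_le_mul_of_nonneg_left hdmR (inv_nonneg.2 hmR.le)
          _ = (P.degree : ℝ) := by
              rw [mul_comm (P.degree : ℝ), ← mul_assoc, inv_mul_cancel₀ hmR.ne', one_mul]
      linarith
  have hlog0 : ∀ v : HeightOneSpectrum (𝓞 P.F), 0 ≤ Real.log ((absNorm v.asIdeal : ℕ) : ℝ) := fun v => by
    have h1 : (1 : ℝ) ≤ (absNorm v.asIdeal : ℕ) := by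
      exact_mod_cast Nat.one_le_iff_ne_zero.mpr (by rw [Ne, Ideal.absNorm_eq_zero_iff]; exact v.ne_bot)
    exact Real.log_nonneg h1
  -- per part
  have hfac0 : max 0 (1 - (P.degree : ℝ) / ((l : ℝ) - 1)) ≤ 1 - (m v₀ : ℝ)⁻¹ := by
    have := hfac v₀; rwa [hres] at this
  have hfac3 : ∀ v ∈ G3, max 0 (1 - (P.degree : ℝ) / 2) ≤ 1 - (m v : ℝ)⁻¹ := by
    intro v hv
    have := hfac v
    rw [hres3 v hv] at this
    have e : ((3 : ℕ) : ℝ) - 1 = 2 := by norm_num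
    rwa [e] at this
  have hfac5 : ∀ v ∈ G5, max 0 (1 - (P.degree : ℝ) / 4) ≤ 1 - (m v : ℝ)⁻¹ := by
    intro v hv
    have := hfac v
    rw [hres5 v hv] at this
    have e : ((5 : ℕ) : ℝ) - 1 = 4 := by norm_num
    rwa [e] at this
  have hN : Ideal.absNorm v₀.asIdeal = l ^ resDeg P.F v₀ := by rw [absNorm_eq, hres]
  have hlN : (l : ℝ) ≤ ((Ideal.absNorm v₀.asIdeal : ℕ) : ℝ) := by
    rw [hN]; push_cast
    exact le_self_pow₀ (by exact_mod_cast hl.one_lt.le) (resDeg_ne_zero P.F v₀)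
  have hlogl : 0 ≤ Real.log l := Real.log_nonneg (by exact_mod_cast hl.one_lt.le)
  have hnorm : Real.log l ≤ Real.log ((Ideal.absNorm v₀.asIdeal : ℕ) : ℝ) :=
    Real.log_le_log (by exact_mod_cast hl.pos) hlN
  have hb0 : max 0 (1 - (P.degree : ℝ) / ((l : ℝ) - 1)) * Real.log l ≤
      (1 - (m v₀ : ℝ)⁻¹) * Real.log ((absNorm v₀.asIdeal : ℕ) : ℝ) :=
    mul_le_mul hfac0 hnorm hlogl (le_trans (le_max_left _ _) hfac0)
  have hb3 : max 0 (1 - (P.degree : ℝ) / 2) * ∑ v ∈ G3, Real.log ((absNorm v.asIdeal : ℕ) : ℝ) ≤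
      ∑ v ∈ G3, (1 - (m v : ℝ)⁻¹) * Real.log ((absNorm v.asIdeal : ℕ) : ℝ) := by
    rw [Finset.mul_sum]
    exact Finset.sum_le_sum fun v hv => mul_le_mul_of_nonneg_right (hfac3 v hv) (hlog0 v)
  have hb5 : max 0 (1 - (P.degree : ℝ) / 4) * ∑ v ∈ G5, Real.log ((absNorm v.asIdeal : ℕ) : ℝ) ≤
      ∑ v ∈ G5, (1 - (m v : ℝ)⁻¹) * Real.log ((absNorm v.asIdeal : ℕ) : ℝ) := by
    rw [Finset.mul_sum]
    exact Finset.sum_le_sum fun v hv => mul_le_mul_of_nonneg_right (hfac5 v hv) (hlog0 v)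
  -- splitting the `Sₓ`-sum
  have hsplit : ∑ v ∈ Sx, (1 - (m v : ℝ)⁻¹) * Real.log ((absNorm v.asIdeal : ℕ) : ℝ) =
      (1 - (m v₀ : ℝ)⁻¹) * Real.log ((absNorm v₀.asIdeal : ℕ) : ℝ)
        + ∑ v ∈ G3, (1 - (m v : ℝ)⁻¹) * Real.log ((absNorm v.asIdeal : ℕ) : ℝ)
        + ∑ v ∈ G5, (1 - (m v : ℝ)⁻¹) * Real.log ((absNorm v.asIdeal : ℕ) : ℝ) := by
    rw [hSx, Finset.sum_union hdisU5, Finset.sum_union hdis03, Finset.sum_singleton]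
  have hgain : max 0 (1 - (P.degree : ℝ) / ((l : ℝ) - 1)) * ((P.degree : ℝ)⁻¹ * Real.log l)
        + max 0 (1 - (P.degree : ℝ) / 2) * ((P.degree : ℝ)⁻¹ *
            ∑ v ∈ G3, Real.log ((absNorm v.asIdeal : ℕ) : ℝ))
        + max 0 (1 - (P.degree : ℝ) / 4) * ((P.degree : ℝ)⁻¹ *
            ∑ v ∈ G5, Real.log ((absNorm v.asIdeal : ℕ) : ℝ)) ≤
      (P.degree : ℝ)⁻¹ * ∑ v ∈ Sx, (1 - (m v : ℝ)⁻¹) * Real.log ((absNorm v.asIdeal : ℕ) : ℝ) := by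
    rw [hsplit]
    have e : max 0 (1 - (P.degree : ℝ) / ((l : ℝ) - 1)) * ((P.degree : ℝ)⁻¹ * Real.log l)
        + max 0 (1 - (P.degree : ℝ) / 2) * ((P.degree : ℝ)⁻¹ *
            ∑ v ∈ G3, Real.log ((absNorm v.asIdeal : ℕ) : ℝ))
        + max 0 (1 - (P.degree : ℝ) / 4) * ((P.degree : ℝ)⁻¹ *
            ∑ v ∈ G5, Real.log ((absNorm v.asIdeal : ℕ) : ℝ)) =
        (P.degree : ℝ)⁻¹ * (max 0 (1 - (P.degree : ℝ) / ((l : ℝ) - 1)) * Real.log l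
          + max 0 (1 - (P.degree : ℝ) / 2) * ∑ v ∈ G3, Real.log ((absNorm v.asIdeal : ℕ) : ℝ)
          + max 0 (1 - (P.degree : ℝ) / 4) * ∑ v ∈ G5, Real.log ((absNorm v.asIdeal : ℕ) : ℝ)) := by ring
    rw [e]
    exact mul_le_mul_of_nonneg_left (add_le_add (add_le_add hb0 hb3) hb5) (inv_nonneg.2 hdR.le)
  have hC : 0 ≤ ((l : ℝ) + 5) / 4 - (dmod P : ℝ) := by linarith
  have hgainC : (((l : ℝ) + 5) / 4 - dmod P) * (P.logDiff + (1 - 1 / (l : ℝ)) * logCondAvoid P {2, l}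
          + max 0 (1 - (P.degree : ℝ) / ((l : ℝ) - 1)) * ((P.degree : ℝ)⁻¹ * Real.log l)
          + max 0 (1 - (P.degree : ℝ) / 2) * ((P.degree : ℝ)⁻¹ *
              ∑ v ∈ G3, Real.log ((absNorm v.asIdeal : ℕ) : ℝ))
          + max 0 (1 - (P.degree : ℝ) / 4) * ((P.degree : ℝ)⁻¹ *
              ∑ v ∈ G5, Real.log ((absNorm v.asIdeal : ℕ) : ℝ))) ≤
      (((l : ℝ) + 5) / 4 - dmod P) * (P.logDiff + (1 - 1 / (l : ℝ)) * logCondAvoid P {2, l}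
          + (P.degree : ℝ)⁻¹ * ∑ v ∈ Sx, (1 - (m v : ℝ)⁻¹) * Real.log ((absNorm v.asIdeal : ℕ) : ℝ)) :=
    mul_le_mul_of_nonneg_left (by linarith [hgain]) hC
  refine T.cor312PerImageOf_of_le_logDiff_logCond_ramified_fun hU hl.pos hd Sx hdisjSx m (fun v _ => hm0 v) hram ?_
  have harch : ThetaVolumeInput.archLogTheta l = ((l : ℝ) + 5) / 4 * Real.log Real.pi := rfl
  rw [harch]
  linarith [h, hgainC]

/-! ## 5. Monotonicity: the one-layer test (p475570) implies the two-layer test -/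

open scoped Classical in
/-- **p475570's inequality implies this file's**: under `d_mod ≤ (l+5)/4` (so the coefficient is `≥ 0`), `max(0, 1 − d/(l−1)) ≥ 1 − d/(l−1)`,
`(1/d)·log l ≥ 0`, and the two new terms are `≥ 0`. Hence every ζ-cut binder built on `cor312PerImageOf_of_le_degree_thirty` is WEAKER-OR-EQUAL
than the corresponding one built on `cor312PerImageOf_of_le_degree` (the junction files use this). Pure real arithmetic.
[claim: Mochizuki2012, status: disputed] -/
theorem le_degree_thirty_of_le_degree {P : NFPoint} {l : ℕ} (hl : l.Prime)
    (hd : (dmod P : ℝ) ≤ ((l : ℝ) + 5) / 4)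
    (h : (((l : ℝ) + 1) / 24 - 1 / (2 * l)) * logQAvoid P {2, l} ≤
      (((l : ℝ) + 5) / 4 - dmod P) * (P.logDiff + (1 - 1 / (l : ℝ)) * logCondAvoid P {2, l}
          + (1 - (P.degree : ℝ) / ((l : ℝ) - 1)) * ((P.degree : ℝ)⁻¹ * Real.log l))
        + ((l : ℝ) + 5) / 4 * Real.log Real.pi) :
    (((l : ℝ) + 1) / 24 - 1 / (2 * l)) * logQAvoid P {2, l} ≤
      (((l : ℝ) + 5) / 4 - dmod P) * (P.logDiff + (1 - 1 / (l : ℝ)) * logCondAvoid P {2, l}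
          + max 0 (1 - (P.degree : ℝ) / ((l : ℝ) - 1)) * ((P.degree : ℝ)⁻¹ * Real.log l)
          + max 0 (1 - (P.degree : ℝ) / 2) * ((P.degree : ℝ)⁻¹ *
              ∑ v ∈ placesOver P.F 3 \ badPlacesAvoid P {2, l}, Real.log (absNorm v.asIdeal : ℝ))
          + max 0 (1 - (P.degree : ℝ) / 4) * ((P.degree : ℝ)⁻¹ *
              ∑ v ∈ placesOver P.F 5 \ badPlacesAvoid P {2, l}, Real.log (absNorm v.asIdeal : ℝ)))
        + ((l : ℝ) + 5) / 4 * Real.log Real.pi := by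
  have hC : 0 ≤ ((l : ℝ) + 5) / 4 - (dmod P : ℝ) := by linarith
  have hdR : (0 : ℝ) < (P.degree : ℝ) := by exact_mod_cast P.degree_pos
  have hlogl : 0 ≤ Real.log l := Real.log_nonneg (by exact_mod_cast hl.one_lt.le)
  have hlog0 : ∀ v : HeightOneSpectrum (𝓞 P.F), 0 ≤ Real.log ((absNorm v.asIdeal : ℕ) : ℝ) := fun v => by
    have h1 : (1 : ℝ) ≤ (absNorm v.asIdeal : ℕ) := by
      exact_mod_cast Nat.one_le_iff_ne_zero.mpr (by rw [Ne, Ideal.absNorm_eq_zero_iff]; exact v.ne_bot)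
    exact Real.log_nonneg h1
  have hX : 0 ≤ (P.degree : ℝ)⁻¹ * Real.log l := mul_nonneg (inv_nonneg.2 hdR.le) hlogl
  have h1 : (1 - (P.degree : ℝ) / ((l : ℝ) - 1)) * ((P.degree : ℝ)⁻¹ * Real.log l) ≤
      max 0 (1 - (P.degree : ℝ) / ((l : ℝ) - 1)) * ((P.degree : ℝ)⁻¹ * Real.log l) :=
    mul_le_mul_of_nonneg_right (le_max_right _ _) hX
  have h3 : 0 ≤ max 0 (1 - (P.degree : ℝ) / 2) * ((P.degree : ℝ)⁻¹ *
      ∑ v ∈ placesOver P.F 3 \ badPlacesAvoid P {2, l}, Real.log ((absNorm v.asIdeal : ℕ) : ℝ)) :=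
    mul_nonneg (le_max_left _ _) (mul_nonneg (inv_nonneg.2 hdR.le) (Finset.sum_nonneg fun v _ => hlog0 v))
  have h5 : 0 ≤ max 0 (1 - (P.degree : ℝ) / 4) * ((P.degree : ℝ)⁻¹ *
      ∑ v ∈ placesOver P.F 5 \ badPlacesAvoid P {2, l}, Real.log ((absNorm v.asIdeal : ℕ) : ℝ)) :=
    mul_nonneg (le_max_left _ _) (mul_nonneg (inv_nonneg.2 hdR.le) (Finset.sum_nonneg fun v _ => hlog0 v))
  have hmono : (((l : ℝ) + 5) / 4 - dmod P) * (P.logDiff + (1 - 1 / (l : ℝ)) * logCondAvoid P {2, l}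
          + (1 - (P.degree : ℝ) / ((l : ℝ) - 1)) * ((P.degree : ℝ)⁻¹ * Real.log l)) ≤
      (((l : ℝ) + 5) / 4 - dmod P) * (P.logDiff + (1 - 1 / (l : ℝ)) * logCondAvoid P {2, l}
          + max 0 (1 - (P.degree : ℝ) / ((l : ℝ) - 1)) * ((P.degree : ℝ)⁻¹ * Real.log l)
          + max 0 (1 - (P.degree : ℝ) / 2) * ((P.degree : ℝ)⁻¹ *
              ∑ v ∈ placesOver P.F 3 \ badPlacesAvoid P {2, l}, Real.log (absNorm v.asIdeal : ℝ))
          + max 0 (1 - (P.degree : ℝ) / 4) * ((P.degree : ℝ)⁻¹ *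
              ∑ v ∈ placesOver P.F 5 \ badPlacesAvoid P {2, l}, Real.log (absNorm v.asIdeal : ℝ))) :=
    mul_le_mul_of_nonneg_left (by linarith [h1, h3, h5]) hC
  linarith [h, hmono]

end Literature.IUT.LogVolume.Cor22

end
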